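import Summits.QuantumFields.YangMills.Theorems.AlphaInputsT3ACFlatGaussianDefs
import Summits.QuantumFields.YangMills.Theorems.BalabanUVNodesN08AlphaZeroDataRows
import HarnessLib

/-!
# `AlphaInputsT3ACFlatGaussianRows` — ROWS #13 (`logZT`) AND #12 (`norm35`) OF THE (α) TABLE FOR THE B0∣_{U=1} FIELDS of ✓`AlphaInputsT3ACFlatGaussianDefs` (`dimT, QT, JT;
# dimZ h, Q1 h, J1 h` over the [B6] torus objects `elimT` ∕ `deltaPol` ∕ `elimLam`): the Loewner letters, the counts of #13, and the `Norm35Model` presentation of #12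

Cell `ym3-torus` (HUMAN RULING D-0037, YM ladder rung R3), width seat `ym3-torus-px8` g17 — the B0∣_{U=1} DEFINER's file 2a (★★OWNER ym3-torus-plan g36 WORD №106 +
«DEFINER SETTLED: px8 g17»; spec px8 g16 `LOCATE-B0flat-definer-spec-px8g16.v1_1.md`, 19936 evidence, RECORDs 17cj∕17cp∕17cq∕17cw).  `--supports stmt-QuantumFields-19936 --as helper`;
THEOREMS ONLY (def-free — every `def` used is ✓`AlphaInputsT3ACFlatGaussianDefs`), sorry-free, standard axioms; [folklore] bookkeeping over LANDED tree theorems BY NAME.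
CREDIT NOTHING: nothing of [Balaban1985UV3] is asserted; (α) data rows 0∕23 — rows #12∕#13 are closed here for the DRAFTED fields, not for Bałaban's witness `𝔖_Bal`.

WHAT IS PROVED.  §0 folklore: (F1) ★`integral_quadExp_reindex` (Lebesgue measure on `ℝ^ι` is invariant under relabelling, `MeasureTheory.volume_measurePreserving_piCongrLeft`);
submatrix∕block bookkeeping.  §2 ROW #13: `sideT_dvd` (`L ∣ Mₖ`, `k < m + K`), `dimT_le` (`dimT ≤ 9|T₁^{(k)}|`), `abs_JT_le` (`|JT| ≤ 27 log L·|T₁^{(k)}|`), `QT_loewner`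
(✓`loewner_letters_reindex_blockDiagonal` at the definer's `eT`), ★`logZT_row_of_fields (hT : (𝔖 k).JT + gaussLog (𝔖 k).QT = JT S k + gaussLog (QT S k)) :
LogZTExtensiveAsCited (piecesAC 𝔎 X 𝔖 k) (gamma2153 3 L) (aT L) 9 (27 log L)` (+ the literal `example` through ✓`logZTExtensiveAsCited_piecesAC_of_loewner`).  §3 ROW #12:
`sigmaT`-split of the variables (Λ-bonds first), ★`QTsplit_toBlocks₁₁ : (reindex σ σ QT).toBlocks₁₁ = Q1 h` (the common core), `fromBlocks_eq_QTsplit`, `Q1_loewner`, `lower₁`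
(from `lower₂` by `PosSemidef.submatrix`), `lower₂`, `upper₂`, `log_integral_fromBlocks_eq`∕`…_empty_eq` ((F1)), ★`norm35_row_of_fields (hT) (hZ) (hcount) (hjac) :
Norm35StepAsCited (piecesAC 𝔎 X 𝔖 k) (gamma2153 3 L) (aT L) cv cJ` — the two counts are discharged in file 2b `AlphaInputsT3ACFlatGaussianCounts`.
KERNEL NOTE (K1): the ℕ-valued fields `dimT dimZ dimC` are `[irreducible]` in the Defs file; `unfold`∕`rw [dimT]` still see through the seal.
HONEST SCOPE: (O‴χₛ), `HistoryTailL` (19936), 19200, 20520, `YM3TorusSU2` NOT proved; rung R3 = SU(2) YM₃ on T³ — NOT d = 4, NOT infinite volume, NOT a mass gap, NOT Clay.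
References: T. Bałaban, CMP 102 (1985) 255–275 [Balaban1985UV3] ((22) p.261, (35) p.265, (61)–(63) pp.271–272); CMP 96 (1984) 223–250 [Balaban1984PropagatorsII]
((2.152)–(2.157) pp.249–250); CMP 95 (1984) 17–40 [Balaban1984PropagatorsI] ((1.66)–(1.67) p.29); CMP 99 (1985) 389–434 [Balaban1985BackgroundPropagators] (p.428).
-/

set_option autoImplicit false

noncomputable section

open MeasureTheory Finset Matrix

namespace Summit.QuantumFields.YangMills.Theorems.AlphaInputsT3ACFlatGaussian

open Literature.MathematicalPhysics.QuantumFieldTheory.Balaban1983to89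
open Literature.MathematicalPhysics.QuantumFieldTheory.Balaban1983to89.B6Lemma24Torus (pbox coarseSites faces mem_faces)
open Literature.MathematicalPhysics.QuantumFieldTheory.Balaban1983to89.B6Cov2156Torus (freeT elimT deltaPol gamma2153)
open Literature.MathematicalPhysics.QuantumFieldTheory.Balaban1983to89.B6Cov2156TorusSubset (elimTS lamFree lamFree_subset elimLam)
open Literature.MathematicalPhysics.QuantumFieldTheory.Balaban1983to89.B6LowerBound2153Torus (facesOf)
open Literature.MathematicalPhysics.QuantumFieldTheory.Balaban1983to89.B10Eq35Norm (Norm35Model)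
open Literature.MathematicalPhysics.QuantumFieldTheory.Balaban1985CMP102
open Literature.MathematicalPhysics.QuantumFieldTheory.Balaban1985CMP102.Setting
open Literature.MathematicalPhysics.QuantumFieldTheory.Balaban1985CMP102.Binders (Norm35StepAsCited LogZTExtensiveAsCited LogZTModel)
open Summit.QuantumFields.Balaban3D.Carriers
open Summit.QuantumFields.Balaban3D.Proofs.ScalesArithmetic (sites_eq_card P_d P_L P_m P_K)
open Summit.QuantumFields.Balaban3D.Proofs.Inputs
open Summit.QuantumFields.Balaban3D.Proofs.TowerAC
open Summit.QuantumFields.Balaban3D.Proofs.SeriesAC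
open Summit.QuantumFields.Balaban3D.Proofs.StandardAC
open Summit.QuantumFields.Balaban3D.Proofs.InputsAC
open Summit.QuantumFields.YangMills.Theorems.AlphaInputsT3ACNorm35LogZTRowsOfLeaves
  (logZTExtensiveAsCited_piecesAC_of_loewner piecesAC_logZT_eq piecesAC_logZ1_eq)
open Summit.QuantumFields.YangMills.Theorems.AlphaInputsT3ACFlatLoewnerLetters (loewner_letters_reindex_blockDiagonal)

/-! ## §0 Folklore -/

section Folklore

/-- **(F1)** Lebesgue measure on `ℝ^ι` is invariant under relabelling the coordinates along `e : ι ≃ κ`: the Gaussian-type integral of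
`reindex e e Q` over `ℝ^κ` is that of `Q` over `ℝ^ι` (`MeasureTheory.volume_measurePreserving_piCongrLeft`). [folklore] -/
theorem integral_quadExp_reindex {ι κ : Type} [Fintype ι] [Fintype κ] (e : ι ≃ κ) (Q : Matrix ι ι ℝ) :
    (∫ w : κ → ℝ, Real.exp (-(1 / 2 : ℝ) * (w ⬝ᵥ (Matrix.reindex e e Q) *ᵥ w))) =
      ∫ v : ι → ℝ, Real.exp (-(1 / 2 : ℝ) * (v ⬝ᵥ Q *ᵥ v)) := by
  have h := (volume_measurePreserving_piCongrLeft (fun _ : κ => ℝ) e).integral_comp'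
    (g := fun w : κ → ℝ => Real.exp (-(1 / 2 : ℝ) * (w ⬝ᵥ (Matrix.reindex e e Q) *ᵥ w)))
  rw [← h]
  congr 1
  funext v
  have hv : (MeasurableEquiv.piCongrLeft (fun _ : κ => ℝ) e) v = v ∘ e.symm := by
    funext a
    simp only [MeasurableEquiv.coe_piCongrLeft, Equiv.piCongrLeft_apply_eq_cast, cast_eq, Function.comp_apply]
  have hm : Matrix.reindex e e Q *ᵥ (v ∘ e.symm) = (Q *ᵥ v) ∘ e.symm := by
    rw [Matrix.reindex_apply, Matrix.submatrix_mulVec_equiv]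
    have hc : (v ∘ ⇑e.symm) ∘ ⇑e.symm.symm = v := by
      funext i
      simp only [Function.comp_apply, Equiv.symm_symm, Equiv.symm_apply_apply]
    rw [hc]
  simp only [hv, hm, comp_equiv_dotProduct_comp_equiv]

/-- `(A − c•1).submatrix f f = A.submatrix f f − c•1` for `f` injective. [folklore] -/
theorem submatrix_sub_smul_one {ι κ : Type} [DecidableEq ι] [DecidableEq κ] (A : Matrix ι ι ℝ) (c : ℝ) (f : κ → ι)
    (hf : Function.Injective f) :
    (A - c • (1 : Matrix ι ι ℝ)).submatrix f f = A.submatrix f f - c • (1 : Matrix κ κ ℝ) := by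
  rw [Matrix.submatrix_sub, Pi.sub_apply, Pi.sub_apply, Matrix.submatrix_smul, Pi.smul_apply, Pi.smul_apply,
    Matrix.submatrix_one f hf]

/-- `(a•1 − A).submatrix f f = a•1 − A.submatrix f f` for `f` injective. [folklore] -/
theorem submatrix_smul_one_sub {ι κ : Type} [DecidableEq ι] [DecidableEq κ] (A : Matrix ι ι ℝ) (a : ℝ) (f : κ → ι)
    (hf : Function.Injective f) :
    (a • (1 : Matrix ι ι ℝ) - A).submatrix f f = a • (1 : Matrix κ κ ℝ) - A.submatrix f f := by
  rw [Matrix.submatrix_sub, Pi.sub_apply, Pi.sub_apply, Matrix.submatrix_smul, Pi.smul_apply, Pi.smul_apply,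
    Matrix.submatrix_one f hf]

/-- A symmetric matrix over `α ⊕ β` is the `fromBlocks` of its blocks with `B₂₁ = B₁₂ᴴ`. [folklore] -/
theorem fromBlocks_toBlocks_of_isSymm {α β : Type} (N : Matrix (α ⊕ β) (α ⊕ β) ℝ) (hN : N.IsSymm) :
    Matrix.fromBlocks N.toBlocks₁₁ N.toBlocks₁₂ N.toBlocks₁₂ᴴ N.toBlocks₂₂ = N := by
  have h21 : N.toBlocks₁₂ᴴ = N.toBlocks₂₁ := by
    ext i j
    simp only [Matrix.conjTranspose_apply, Matrix.toBlocks₁₂, Matrix.toBlocks₂₁, Matrix.of_apply, star_trivial]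
    exact hN.apply _ _
  rw [h21, Matrix.fromBlocks_toBlocks]

/-- Over `α ⊕ Fin 0`, `fromBlocks K 0 0ᴴ 0` is `K` relabelled along `(Equiv.sumEmpty α (Fin 0)).symm`. [folklore] -/
theorem fromBlocks_empty_eq_reindex {α : Type} (K : Matrix α α ℝ) :
    Matrix.fromBlocks K (0 : Matrix α (Fin 0) ℝ) (0 : Matrix α (Fin 0) ℝ)ᴴ (0 : Matrix (Fin 0) (Fin 0) ℝ) =
      Matrix.reindex (Equiv.sumEmpty α (Fin 0)).symm (Equiv.sumEmpty α (Fin 0)).symm K := by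
  ext (i | i) (j | j)
  · rfl
  · exact j.elim0
  · exact i.elim0
  · exact i.elim0

end Folklore

/-! ## §1 The six fields over the named [B6] objects -/

section Defs

variable {L : ℕ} (S : Scales L) (k : ℕ)

variable (K₀ : CarrierConsts)

end Defs

/-! ## §2 Row #13 (`logZT`): Loewner letters, counts, the row -/

section Row13

variable {L : ℕ}

/-- `1 ≤ L` (from `Scales.hL : Odd L ∧ 1 < L`). [folklore] -/
theorem one_le_L (S : Scales L) : 1 ≤ L := S.hL.2.le

/-- `1 ≤ L^k`. [folklore] -/
theorem one_le_L_pow (S : Scales L) (k : ℕ) : 1 ≤ L ^ k := Nat.one_le_pow _ _ (one_le_L S)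

variable (S : Scales L) (k : ℕ)

/-- `L ∣ Mₖ = 2·L^{m+K−k}` for every run step `k < m + K`. [folklore] -/
theorem sideT_dvd (hk : k < S.m + S.K) : ∀ i, L ∣ sideT S k i := fun _ => by
  show L ∣ 2 * S.P.L ^ (S.P.m + S.P.K - k)
  rw [P_L, P_m, P_K]
  exact Dvd.dvd.mul_left (dvd_pow_self L (by omega)) 2

/-- `|pbox Mₖ| = Mₖ³`. [folklore] -/
theorem card_pbox_sideT : (pbox (sideT S k)).card = S.P.sitesPerDir k ^ 3 := by
  unfold pbox
  rw [Fintype.card_piFinset]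
  show ∏ _i : Fin 3, (Finset.Ico (0 : ℤ) (S.P.sitesPerDir k : ℤ)).card = _
  rw [Finset.prod_const, Finset.card_univ, Fintype.card_fin, Int.card_Ico, sub_zero, Int.toNat_natCast]

/-- `|T₁^{(k)}| = Mₖ³` (`ScalesArithmetic.sites_eq_card` + `Site.card_site`). [cite: Balaban1985UV3, (5) p.256] -/
theorem sites_eq_pow (hk : k ≤ S.m + S.K) : S.sites k = ((S.P.sitesPerDir k ^ 3 : ℕ) : ℝ) := by
  rw [sites_eq_card S k hk, Site.card_site, P_d]

/-- **`hcount` of #13**: `dimT ≤ 9·|T₁^{(k)}|` (three colours × at most three bonds per site). [cite: Balaban1985UV3, (62)–(63) pp.271–272] -/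
theorem dimT_le (hk : k ≤ S.m + S.K) : (dimT S k : ℝ) ≤ 9 * S.sites k := by
  rw [sites_eq_pow S k hk]
  have h1 : (freeT L (sideT S k)).card ≤ (pbox (sideT S k)).card * 3 := by
    calc (freeT L (sideT S k)).card ≤ Fintype.card (B4.Idx (pbox (sideT S k)) 3) := Finset.card_le_univ _
      _ = (pbox (sideT S k)).card * 3 := by rw [Fintype.card_prod, Fintype.card_coe, Fintype.card_fin]
  have h2 : dimT S k ≤ 9 * S.P.sitesPerDir k ^ 3 := by
    unfold dimT
    rw [Fintype.card_prod, Fintype.card_coe, Fintype.card_fin, ← card_pbox_sideT S k]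
    omega
  exact_mod_cast h2

/-- **`hjac` of #13**: `|JT| ≤ 27·log L·|T₁^{(k)}|`. [cite: Balaban1985UV3, (62) p.271] -/
theorem abs_JT_le (hk : k ≤ S.m + S.K) : |JT S k| ≤ 27 * Real.log L * S.sites k := by
  rw [sites_eq_pow S k hk]
  have hL : (1 : ℝ) ≤ L := by exact_mod_cast one_le_L S
  have hlog : 0 ≤ Real.log (L : ℝ) := Real.log_nonneg hL
  have hf : ((faces L (sideT S k)).card : ℝ) ≤ 3 * ((S.P.sitesPerDir k ^ 3 : ℕ) : ℝ) := by
    have : (faces L (sideT S k)).card ≤ 3 * S.P.sitesPerDir k ^ 3 := by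
      unfold faces
      rw [Finset.card_product, Finset.card_univ, Fintype.card_fin, ← card_pbox_sideT S k]
      have hsub : coarseSites L (sideT S k) ⊆ pbox (sideT S k) := Finset.filter_subset _ _
      have := Finset.card_le_card hsub
      omega
    exact_mod_cast this
  have hJ : JT S k = 9 * Real.log L * (faces L (sideT S k)).card := by
    unfold JT
    rw [Real.log_pow]
    push_cast
    ring
  rw [hJ, abs_of_nonneg (by positivity)]
  nlinarith

/-- **THE LOEWNER LETTERS OF THE DRAFT's `QT`** — ✓`loewner_letters_reindex_blockDiagonal` at `d = 3`, `M = sideT S k`, `n = L^k`, `e = eT S k`: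
`γ′₀•1 ⪯ QT ⪯ a•1`, `γ′₀ = gamma2153 3 L`, `a = aT L`. [cite: Balaban1984PropagatorsII, (2.157) p.250; Balaban1985UV3, p.272 L1–2] -/
theorem QT_loewner (hk : k < S.m + S.K) :
    (QT S k - gamma2153 3 L • (1 : Matrix (Fin (dimT S k)) (Fin (dimT S k)) ℝ)).PosSemidef ∧
      (aT L • (1 : Matrix (Fin (dimT S k)) (Fin (dimT S k)) ℝ) - QT S k).PosSemidef :=
  loewner_letters_reindex_blockDiagonal (d := 3) (by norm_num) (one_le_L S) (sideT_dvd S k hk) (L ^ k) (one_le_L_pow S k) (eT S k)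

variable (𝔎 : LaneConsts L) {S} {G : Type} [GaugeGroup G] [MeasurableSpace G] [HaarData G]
  {V : Type} [NormedAddCommGroup V] [NormedSpace ℂ V] (X : ExternalInputsAC S G)

/-- ★ **ROW #13 FOR THE DRAFT's FIELDS** (spec D4 shape): any expansion data `𝔖` whose (62)-number `JT + log ∫ e^{−½⟨v, QT v⟩}` at step `k` is the draft's satisfies
`LogZTExtensiveAsCited (piecesAC 𝔎 X 𝔖 k) γ′₀ a 9 (27 log L)` — the hypothesis `hT` holds by `rfl` the day B0 sets `(𝔖 k).{dimT, QT, JT} := draft`.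
[cite: Balaban1985UV3, (62)–(63) pp.271–272 + (65) p.273] -/
theorem logZT_row_of_fields (hk : k < S.m + S.K) (𝔖 : ∀ j, StepSeries S G V (nblkOf S 𝔎.carrier j) j)
    (hT : (𝔖 k).JT + StepSeries.gaussLog (𝔖 k).QT = JT S k + StepSeries.gaussLog (QT S k)) :
    LogZTExtensiveAsCited (piecesAC 𝔎 X 𝔖 k) (gamma2153 3 L) (aT L) 9 (27 * Real.log L) :=
  ⟨{ dim := dimT S k, Q := QT S k, J := JT S k
     lower := (QT_loewner S k hk).1
     upper := (QT_loewner S k hk).2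
     logZT_eq := by rw [piecesAC_logZT_eq, hT]; rfl
     count_le := dimT_le S k hk.le
     jac_le := abs_JT_le S k hk.le }⟩

/-- The overwritten `QT` IS the draft's (definitional). [folklore] -/
theorem withT_QT {N : ℕ → ℕ} [∀ j, NeZero (N j)] (𝔖₀ : ∀ j, StepSeries S G V (N j) j) (j : ℕ) : (withT (S := S) 𝔖₀ j).QT = QT S j := rfl

/-- The overwritten `JT` IS the draft's (definitional). [folklore] -/
theorem withT_JT {N : ℕ → ℕ} [∀ j, NeZero (N j)] (𝔖₀ : ∀ j, StepSeries S G V (N j) j) (j : ℕ) : (withT (S := S) 𝔖₀ j).JT = JT S j := rfl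

/-- **`example` #13 (★★OWNER ACK 185)**: for `𝔖 := withT 𝔖₀` (`= fun j => {𝔖₀ j with dimT := dimT S j, QT := QT S j, JT := JT S j}`) the door
✓`logZTExtensiveAsCited_piecesAC_of_loewner` closes row #13 by ONE `exact` on ✓`loewner_letters_reindex_blockDiagonal` + the two counts. [cite: Balaban1985UV3, (62)–(63) pp.271–272] -/
example (hk : k < S.m + S.K) (𝔖₀ : ∀ j, StepSeries S G V (nblkOf S 𝔎.carrier j) j) :
    LogZTExtensiveAsCited (piecesAC 𝔎 X (withT (S := S) 𝔖₀) k) (gamma2153 3 L) (aT L) 9 (27 * Real.log L) := by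
  -- (needs the seal `attribute [irreducible] dimT` above: with `dimT` unfoldable this very `exact` is a whnf timeout at 200k heartbeats)
  exact logZTExtensiveAsCited_piecesAC_of_loewner 𝔎 X (withT (S := S) 𝔖₀) k
    (loewner_letters_reindex_blockDiagonal (d := 3) (by norm_num) (one_le_L S) (sideT_dvd S k hk) (L ^ k) (one_le_L_pow S k) (eT S k)).1
    (loewner_letters_reindex_blockDiagonal (d := 3) (by norm_num) (one_le_L S) (sideT_dvd S k hk) (L ^ k) (one_le_L_pow S k) (eT S k)).2
    (dimT_le S k hk.le) (abs_JT_le S k hk.le)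

/-- The same through ★`logZT_row_of_fields` (hypothesis `hT` by `rfl`). [cite: Balaban1985UV3, (62)–(63) pp.271–272] -/
example (hk : k < S.m + S.K) (𝔖₀ : ∀ j, StepSeries S G V (nblkOf S 𝔎.carrier j) j) :
    LogZTExtensiveAsCited (piecesAC 𝔎 X (withT (S := S) 𝔖₀) k) (gamma2153 3 L) (aT L) 9 (27 * Real.log L) :=
  logZT_row_of_fields k 𝔎 X hk (withT (S := S) 𝔖₀) rfl

end Row13

/-! ## §3 Row #12 (`norm35`): the `Norm35Model` presentation at `s := 0` -/

section Row12

variable {L : ℕ} (S : Scales L) (k : ℕ) (K₀ : CarrierConsts) (h : Hist S.P (k + 1))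

/-- `dimC h = 3·#{remaining torus variables that are not Λ-bonds}` (stated before the seal). [folklore] -/
theorem dimC_eq : dimC S k K₀ h =
    Fintype.card {f : ↥(freeT L (sideT S k)) // (f : B4.Idx (pbox (sideT S k)) 3) ∉ lamBonds S k K₀ h} * 3 := by
  unfold dimC
  rw [Fintype.card_prod, Fintype.card_fin]

/-- The split sends the `i`-th Λ-coordinate to the corresponding torus coordinate (definitional). [folklore] -/
theorem splitEquiv_symm_inl (i : Fin (dimZ S k K₀ h)) :
    (splitEquiv S k K₀ h).symm (Sum.inl i) = (inclLam S k K₀ h ((eZ S k K₀ h).symm i).1, ((eZ S k K₀ h).symm i).2) := rfl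

/-- The entries of `C_Λᵀ Δ C_Λ` ARE those of `Cᵀ Δ C` at the included indices (`C_Λ` is the column restriction of `C`). [folklore] -/
theorem sandwichLam_apply (b b' : ↥(lamBonds S k K₀ h)) :
    ((elimLam L (sideT S k) (lamCoarse S k K₀ h))ᵀ * deltaPol (sideT S k) (L ^ k) * elimLam L (sideT S k) (lamCoarse S k K₀ h)) b b' =
      ((elimT L (sideT S k))ᵀ * deltaPol (sideT S k) (L ^ k) * elimT L (sideT S k)) (inclLam S k K₀ h b) (inclLam S k K₀ h b') := by
  simp only [Matrix.mul_apply, Matrix.transpose_apply]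
  rfl

/-- **THE COMMON CORE**: the top-left block of `QT` in split coordinates IS `Q1 h`. [cite: Balaban1985UV3, (35) p.265 + (61)–(62) p.271] -/
theorem QTsplit_toBlocks₁₁ : (QTsplit S k K₀ h).toBlocks₁₁ = Q1 S k K₀ h := by
  ext i j
  simp only [QTsplit, sigmaT, QT, Q1, Matrix.toBlocks₁₁, Matrix.of_apply, Matrix.reindex_apply, Matrix.submatrix_apply,
    Equiv.symm_trans_apply, Equiv.symm_symm, Equiv.symm_apply_apply, splitEquiv_symm_inl, Matrix.blockDiagonal_apply,
    sandwichLam_apply]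

/-- `Cᵀ Δ_k C` tripled and relabelled is symmetric. [folklore] -/
theorem QT_isSymm : (QT S k).IsSymm := by
  have hc : ((elimT L (sideT S k))ᵀ * deltaPol (sideT S k) (L ^ k) * elimT L (sideT S k)).IsSymm :=
    B6FromB4.sandwich_isSymm _ (B6Cov2156Torus.deltaPol_isSymm _ _)
  have hb : (blockDiagonal fun _ : Fin 3 => (elimT L (sideT S k))ᵀ * deltaPol (sideT S k) (L ^ k) * elimT L (sideT S k)).IsSymm := by
    unfold Matrix.IsSymm
    rw [Matrix.blockDiagonal_transpose]
    exact congrArg _ (funext fun _ => hc)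
  unfold QT
  rw [Matrix.reindex_apply]
  exact hb.submatrix _

/-- **`QT` IN SPLIT COORDINATES IS THE `fromBlocks` OF THE (35) PRESENTATION** with core `Q1 h`. [cite: Balaban1985UV3, (35) p.265] -/
theorem fromBlocks_eq_QTsplit :
    Matrix.fromBlocks (Q1 S k K₀ h) (QTsplit S k K₀ h).toBlocks₁₂ (QTsplit S k K₀ h).toBlocks₁₂ᴴ (QTsplit S k K₀ h).toBlocks₂₂ = QTsplit S k K₀ h := by
  rw [← QTsplit_toBlocks₁₁]
  refine fromBlocks_toBlocks_of_isSymm _ ?_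
  unfold QTsplit
  rw [Matrix.reindex_apply]
  exact (QT_isSymm S k).submatrix _

/-- `Q1 h` is a principal submatrix of `QT`. [folklore] -/
theorem Q1_eq_submatrix :
    Q1 S k K₀ h = (QT S k).submatrix (fun i => (sigmaT S k K₀ h).symm (Sum.inl i)) (fun i => (sigmaT S k K₀ h).symm (Sum.inl i)) := by
  rw [← QTsplit_toBlocks₁₁]
  rfl

/-- `lower` for the core: `γ′₀•1 ⪯ Q1 h` (a principal submatrix of `QT ⪰ γ′₀•1`; equivalently ✓`sandwich_lowerS`). [cite: Balaban1984PropagatorsII, (2.157) p.250] -/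
theorem Q1_loewner (hk : k < S.m + S.K) :
    (Q1 S k K₀ h - gamma2153 3 L • (1 : Matrix (Fin (dimZ S k K₀ h)) (Fin (dimZ S k K₀ h)) ℝ)).PosSemidef := by
  have hinj : Function.Injective fun i => (sigmaT S k K₀ h).symm (Sum.inl i) :=
    (sigmaT S k K₀ h).symm.injective.comp Sum.inl_injective
  rw [Q1_eq_submatrix, ← submatrix_sub_smul_one _ _ _ hinj]
  exact (QT_loewner S k hk).1.submatrix _

/-- `lower₁` of the presentation (`s = 0`): `γ′₀•1 ⪯ fromBlocks (Q1 h) 0 0ᴴ 0` over `Fin r ⊕ Fin 0`. [cite: Balaban1985UV3, (35) p.265] -/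
theorem lower₁ (hk : k < S.m + S.K) :
    (Matrix.fromBlocks (Q1 S k K₀ h) (0 : Matrix (Fin (dimZ S k K₀ h)) (Fin 0) ℝ) (0 : Matrix (Fin (dimZ S k K₀ h)) (Fin 0) ℝ)ᴴ
        (0 : Matrix (Fin 0) (Fin 0) ℝ) -
      gamma2153 3 L • (1 : Matrix (Fin (dimZ S k K₀ h) ⊕ Fin 0) (Fin (dimZ S k K₀ h) ⊕ Fin 0) ℝ)).PosSemidef := by
  rw [fromBlocks_empty_eq_reindex, Matrix.reindex_apply, ← submatrix_sub_smul_one _ _ _ (Equiv.injective _)]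
  exact (Q1_loewner S k K₀ h hk).submatrix _

/-- `lower₂` of the presentation: `γ′₀•1 ⪯ fromBlocks (Q1 h) B₂ B₂ᴴ D₂` (= `QT` in split coordinates). [cite: Balaban1985UV3, (35) p.265] -/
theorem lower₂ (hk : k < S.m + S.K) :
    (Matrix.fromBlocks (Q1 S k K₀ h) (QTsplit S k K₀ h).toBlocks₁₂ (QTsplit S k K₀ h).toBlocks₁₂ᴴ (QTsplit S k K₀ h).toBlocks₂₂ -
      gamma2153 3 L • (1 : Matrix (Fin (dimZ S k K₀ h) ⊕ Fin (dimC S k K₀ h)) (Fin (dimZ S k K₀ h) ⊕ Fin (dimC S k K₀ h)) ℝ)).PosSemidef := by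
  rw [fromBlocks_eq_QTsplit]
  unfold QTsplit
  rw [Matrix.reindex_apply, ← submatrix_sub_smul_one _ _ _ (Equiv.injective _)]
  exact (QT_loewner S k hk).1.submatrix _

/-- `upper₂` of the presentation: the complement block `D₂ ⪯ a•1`. [cite: Balaban1985UV3, p.272 L1–2] -/
theorem upper₂ (hk : k < S.m + S.K) :
    (aT L • (1 : Matrix (Fin (dimC S k K₀ h)) (Fin (dimC S k K₀ h)) ℝ) - (QTsplit S k K₀ h).toBlocks₂₂).PosSemidef := by
  have hinj : Function.Injective fun j => (sigmaT S k K₀ h).symm (Sum.inr j) :=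
    (sigmaT S k K₀ h).symm.injective.comp Sum.inr_injective
  have := (QT_loewner S k hk).2.submatrix fun j => (sigmaT S k K₀ h).symm (Sum.inr j)
  rw [submatrix_smul_one_sub _ _ _ hinj] at this
  exact this

/-- The Gaussian of the presentation's whole-lattice form IS `gaussLog QT` ((F1) along `σ_h`). [cite: Balaban1985UV3, (62)–(63) pp.271–272] -/
theorem log_integral_fromBlocks_eq :
    Real.log (∫ w : Fin (dimZ S k K₀ h) ⊕ Fin (dimC S k K₀ h) → ℝ,
        Real.exp (-(1 / 2 : ℝ) * (w ⬝ᵥ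
          Matrix.fromBlocks (Q1 S k K₀ h) (QTsplit S k K₀ h).toBlocks₁₂ (QTsplit S k K₀ h).toBlocks₁₂ᴴ (QTsplit S k K₀ h).toBlocks₂₂ *ᵥ w))) =
      StepSeries.gaussLog (QT S k) := by
  rw [fromBlocks_eq_QTsplit]
  unfold QTsplit StepSeries.gaussLog
  rw [integral_quadExp_reindex]

/-- The Gaussian of the presentation's small-domain form (`s = 0`) IS `gaussLog (Q1 h)` ((F1) along `Fin r ⊕ Fin 0 ≃ Fin r`). [cite: Balaban1985UV3, (61) + (63) pp.271–272] -/
theorem log_integral_fromBlocks_empty_eq :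
    Real.log (∫ v : Fin (dimZ S k K₀ h) ⊕ Fin 0 → ℝ,
        Real.exp (-(1 / 2 : ℝ) * (v ⬝ᵥ
          Matrix.fromBlocks (Q1 S k K₀ h) (0 : Matrix (Fin (dimZ S k K₀ h)) (Fin 0) ℝ) (0 : Matrix (Fin (dimZ S k K₀ h)) (Fin 0) ℝ)ᴴ
            (0 : Matrix (Fin 0) (Fin 0) ℝ) *ᵥ v))) =
      StepSeries.gaussLog (Q1 S k K₀ h) := by
  rw [fromBlocks_empty_eq_reindex]
  unfold StepSeries.gaussLog
  rw [integral_quadExp_reindex]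

variable (𝔎 : LaneConsts L) {S} {G : Type} [GaugeGroup G] [MeasurableSpace G] [HaarData G]
  {V : Type} [NormedAddCommGroup V] [NormedSpace ℂ V] (X : ExternalInputsAC S G)

/-- ★ **ROW #12 FOR THE DRAFT's FIELDS, MODULO THE TWO COUNTS (G1)(G2)** (spec D4 shape): any expansion data `𝔖` whose (62)-number and (61)-numbers at step
`k` are the draft's (`hT`, `hZ` — by `rfl` once B0 sets the six fields) satisfies `Norm35StepAsCited (piecesAC 𝔎 X 𝔖 k) γ′₀ a cv cJ` as soon as the complement
coordinates number `≤ cv·|Z_k(h)|` and the Jacobian constants differ by `≤ cJ·|Z_k(h)|` — with the presentation `r := dimZ h`, `s := 0`, `t := dimC h`, `K := Q1 h`,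
`(B₂, D₂)` := the off-core blocks of `QT` along `σ_h`, `J₁ := J1 h`, `J₂ := JT`. [cite: Balaban1985UV3, (35) p.265 + (61)–(63) pp.271–272] -/
theorem norm35_row_of_fields (hk : k < S.m + S.K) (𝔖 : ∀ j, StepSeries S G V (nblkOf S 𝔎.carrier j) j) {cv cJ : ℝ}
    (hT : (𝔖 k).JT + StepSeries.gaussLog (𝔖 k).QT = JT S k + StepSeries.gaussLog (QT S k))
    (hZ : ∀ hh : Hist S.P (k + 1),
      (𝔖 k).J1 hh + StepSeries.gaussLog ((𝔖 k).Q1 hh) = J1 S k 𝔎.carrier hh + StepSeries.gaussLog (Q1 S k 𝔎.carrier hh))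
    (hcount : ∀ hh : Hist S.P (k + 1), (dimC S k 𝔎.carrier hh : ℝ) ≤ cv * (piecesAC 𝔎 X 𝔖 k).Zvol hh)
    (hjac : ∀ hh : Hist S.P (k + 1), |J1 S k 𝔎.carrier hh - JT S k| ≤ cJ * (piecesAC 𝔎 X 𝔖 k).Zvol hh) :
    Norm35StepAsCited (piecesAC 𝔎 X 𝔖 k) (gamma2153 3 L) (aT L) cv cJ := fun hh =>
  ⟨{ r := dimZ S k 𝔎.carrier hh, s := 0, t := dimC S k 𝔎.carrier hh
     K := Q1 S k 𝔎.carrier hh, B₁ := 0, D₁ := 0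
     B₂ := (QTsplit S k 𝔎.carrier hh).toBlocks₁₂, D₂ := (QTsplit S k 𝔎.carrier hh).toBlocks₂₂
     J₁ := J1 S k 𝔎.carrier hh, J₂ := JT S k
     lower₁ := lower₁ S k 𝔎.carrier hh hk
     upper₁ := BalabanUVNodesN08AlphaZeroDataRows.posSemidef_real_of_isEmpty _
     lower₂ := lower₂ S k 𝔎.carrier hh hk
     upper₂ := upper₂ S k 𝔎.carrier hh hk
     logZ1_eq := by rw [log_integral_fromBlocks_empty_eq, piecesAC_logZ1_eq, hZ hh]
     logZT_eq := by rw [log_integral_fromBlocks_eq, piecesAC_logZT_eq, hT]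
     count_le := by rw [Nat.cast_zero, zero_add]; exact hcount hh
     jac_le := hjac hh }⟩

/-- **`example` #12 (★★OWNER ACK 185)**: for `𝔖 := withTZ 𝔖₀` both hypotheses `hT`, `hZ` of ★`norm35_row_of_fields` hold by `rfl`; what remains of row #12 is EXACTLY
the gap list (G1) `hcount`, (G2) `hjac`. [cite: Balaban1985UV3, (35) p.265] -/
example (hk : k < S.m + S.K) (𝔖₀ : ∀ j, StepSeries S G V (nblkOf S 𝔎.carrier j) j) {cv cJ : ℝ}
    (hcount : ∀ hh : Hist S.P (k + 1),
      (dimC S k 𝔎.carrier hh : ℝ) ≤ cv * (piecesAC 𝔎 X (withTZ (S := S) 𝔎.carrier 𝔖₀) k).Zvol hh)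
    (hjac : ∀ hh : Hist S.P (k + 1),
      |J1 S k 𝔎.carrier hh - JT S k| ≤ cJ * (piecesAC 𝔎 X (withTZ (S := S) 𝔎.carrier 𝔖₀) k).Zvol hh) :
    Norm35StepAsCited (piecesAC 𝔎 X (withTZ (S := S) 𝔎.carrier 𝔖₀) k) (gamma2153 3 L) (aT L) cv cJ :=
  norm35_row_of_fields k 𝔎 X hk (withTZ (S := S) 𝔎.carrier 𝔖₀) rfl (fun _ => rfl) hcount hjac

/-- And row #13 for the same full overwrite. [cite: Balaban1985UV3, (62)–(63) pp.271–272] -/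
example (hk : k < S.m + S.K) (𝔖₀ : ∀ j, StepSeries S G V (nblkOf S 𝔎.carrier j) j) :
    LogZTExtensiveAsCited (piecesAC 𝔎 X (withTZ (S := S) 𝔎.carrier 𝔖₀) k) (gamma2153 3 L) (aT L) 9 (27 * Real.log L) :=
  logZT_row_of_fields k 𝔎 X hk (withTZ (S := S) 𝔎.carrier 𝔖₀) rfl

end Row12

end Summit.QuantumFields.YangMills.Theorems.AlphaInputsT3ACFlatGaussian

end
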